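import Summits.BirchSwinnertonDyer.BirchSwinnertonDyer.Theorems.TameQuarticSolventSolventPairLowerBoundOfV6
import HarnessLib

/-!
# Route `TameQuarticSolvent` — glue item `SolventPairLowerBoundGlue` (stmt-BirchSwinnertonDyer-23966):
# the split children of crux `SolventPairLowerBound` (stmt-BirchSwinnertonDyer-21391) imply the parent

HONEST FRAMING. Pure bookkeeping (the route-level split of 21391 filed by the pss3x pen at rev 3/4): the glue decl
`SolventPublishedInputs → LowerBSD3OverSolventQuartic → KolyvaginUpperRankZeroOverK →
KolyvaginTwistedUpperOverKNoOddMult → SolventPairLowerBound` is closed in one line by the v6 composition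
`solventPairLowerBound_of_published_of_K1low_of_K2aES0_of_K2aRest` (p586547, lead tqs-p1 g3; the children's texts are
the registered v6 stubs verbatim, so the four hypotheses unfold definitionally). Proving the glue proves NONE of the
children: PUB⁸ closes only by Literature `…_holds` discharges, K1⁻ (23963) is open mathematics, K2a-ES₀ (23964) and
K2a-rest (23965) are research statements. BSD is not proved by any of this.
-/

-- D-0017: single-problem summit, so `Summit.BirchSwinnertonDyer.BirchSwinnertonDyer.…` repeats a namespace BY DESIGN.
set_option linter.dupNamespace false

namespace Summit.BirchSwinnertonDyer.BirchSwinnertonDyer.Theorems.SolventPairLowerBound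

/-- **Glue of the split of crux 21391** (item stmt-BirchSwinnertonDyer-23966): the children PUB⁸ (23962), K1⁻
(23963), K2a-ES₀ (23964), K2a-rest (23965) imply `SolventPairLowerBound` — by the v6 composition
`solventPairLowerBound_of_published_of_K1low_of_K2aES0_of_K2aRest` (p586547). Bookkeeping only. [folklore] -/
theorem solventPairLowerBoundGlue_proof :
    Summit.BirchSwinnertonDyer.BirchSwinnertonDyer.Theses.TameQuarticSolvent.SolventPairLowerBoundGlue := by
  unfold Summit.BirchSwinnertonDyer.BirchSwinnertonDyer.Theses.TameQuarticSolvent.SolventPairLowerBoundGlue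
  intro hPUB hK1 hES0 hRest
  exact solventPairLowerBound_of_published_of_K1low_of_K2aES0_of_K2aRest hPUB hK1 hES0 hRest

end Summit.BirchSwinnertonDyer.BirchSwinnertonDyer.Theorems.SolventPairLowerBound
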